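import Mathlib

/-!
# EriceRemainderEnclosureHistoryAutonomyComparisonAgeCompositionUpwardChainJumps — (E98c) route (N), first order, PURE: the upward chain in JUMP FORM
# and THE HAZARD SUPERSOLUTION.  A non-negative sequence `S` that is a SUBSOLUTION of a sub-stochastic upward recursion on a window `[s, s+k)`,
# `S_q ≤ E + Σ_{i<Jw} P_q(i)·S_{q+1+i}` (`P ≥ 0`, `Σ_i P_q(i) ≤ 1`: jump `i+1` with probability `P_q(i)`, killing with the defect), non-negative and
# non-increasing from `s+k` on, satisfies `S_s − S_{s+k} ≤ E·ψ(s)` for every local visit supersolution `ψ` (`window_le_of_subsolution`) — the jump-form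
# twin of (E98a) `window_sum_le`, which the DAMPED tail sums of route (N) obey ((E98d)).  THE HAZARD SUPERSOLUTION: if from every position `q` of the
# window the chain LEAVES the window with probability at least `η_q ≥ 0` and `η_q·(s+k−q−1) ≤ 1` (hazard × remaining length ≤ 1), then
# `ψ(q) = 1 + (1 − η_q)·ψ(q+1)` (`ψ = 0` from `s+k` on) is a non-increasing supersolution with `ψ ≤` remaining length (`hazard_supersolution`); for a
# constant hazard `c`, `c·ψ(q) = 1 − (1 − c)^{s+k−q}` (`hazard_const`): the window is visited at most `(1 − (1−c)^k)∕c` times in expectation, not `k`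
# times — the SATURATION «the targets of an age carry their own reads» asked for in README g82 §2(c)

Cell `pub-balaban`, β-function sub-cell, BINDER row D4 «RemainderConst leaves for Bałaban's split» (`HOME/BINDER-OWNERS.md`; owner lineage `b2b-balaban-beta-an4`;
this file by co-owner #2 lineage `b2b-balaban-beta-d4-p2`, generation 86), β-FLOW TEAM duty (1), FREEZE (0) honoured (def-free; Mathlib only; nothing restated).

HONEST FRAMING (page 1, verbatim and binding).  *"Discharging BetaPertH makes Bałaban's UV stability UNCONDITIONAL — a real constructive-QFT result; it is
NOT the continuum limit and NOT the Clay problem."*  THIS FILE DISCHARGES NOTHING OF THE KIND.  Elementary real algebra about ABSTRACT real sequences —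
hypotheses of a census, not facts; the form, signs, ages and moments of Bałaban's (1.22) limit functional are NOT PRINTED ([I] p. 298; GAPS G-t4-U2-1∕-2)
and NOT asserted.  Row D4 class UNCHANGED (critical-path width 0; instance 0∕1; D4 DISCHARGE NO DATE).  HONEST DEPENDENCY: continuum YM on T⁴ ⇐ BetaPertH ∧
nine spine estimates (0/9 proved); BetaPertH ⇐ (D1) ∧ (D4) ∧ CAP+tail; G-an2-4 gates asym, D1 and NE2/3/4.

THE POINT (README `HOME/b2b-balaban-beta-d4-p2/g86/README.md` §4).  In the window `(m, m+k]` of an age `k` the upward chain of (E98a) leaves the window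
at the latest by its first jump of the age `k` itself (length `k+1`), which occurs at every position with probability `≈ c_k`: the expected number of
visits is at most `Σ_{j<k} (1 − c)^j = (1 − (1−c)^k)∕c ≈ k·(1 − x_k∕2 + …)` (`x_k = k·c_k` the load) instead of `k`, so the read of the age `k` is at
most `e·(1 − (1−c)^k) ≤ e·x_k·(1 − (k−1)x_k∕(2k) + …)` — uniformly in `k`.  The jump form (rather than (E98a)'s tail form) is what the DAMPED system
provides: given the END beyond a pin, the damped tail sums are a subsolution of the sub-stochastic chain with unit-step weight `1 − Σ_k c_k(q)Π_{t=q+1}^{q+k} g_t`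
and long jumps `c_k(q)·g_{q+k}` ((E98d) `damped_tail_subsolution`), whose exit hazard from the window of the age `k` is `≥ c_k(q)g_{q+k}` — essentially
undamped.  NOT CLAIMED: anything along flows (that is (E98d)); anything printed — NOT B12 Thm 2, NOT BetaPertH, NOT continuum, NOT Clay.

WHAT IS PROVED ([folklore]; 0 `def`, 0 sorry; jump weights `P q i` (jump `i+1` from `q`), the sequence `S`, the hazards `η` and `ψ` are displayed data).
§1 **`window_le_of_subsolution`**.  §2 **`hazard_supersolution`** (non-negativity, the bound by the remaining length, monotonicity, the supersolution
inequality), **`hazard_const`** (`c·ψ(q) = 1 − (1−c)^{s+k−q}`), `one_sub_pow_ge` (`(1−c)^k ≥ 1 − k·c`, so `(1 − (1−c)^k) ≤ k·c`: saturation never loses).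
-/
noncomputable section
open Finset

namespace Summit.QuantumFields.BalabanUV.Beta.EriceRemainderEnclosureHistoryAutonomyComparisonAgeCompositionUpwardChainJumps

variable {Jw s k : ℕ} {P : ℕ → ℕ → ℝ} {S ψ η : ℕ → ℝ} {E c : ℝ}

/-! ## §1 The window lemma in jump form -/

/-- **THE WINDOW LEMMA, JUMP FORM.**  Jump weights `P_q(i) ≥ 0` (jump `i+1` from `q`, `i < Jw`) of total mass `≤ 1`; a window `[s, s+k)`; a sequence
`S` with `S_q ≤ E + Σ_i P_q(i)·S_{q+1+i}` on the window (`E ≥ 0`), non-negative and below `S_{s+k}` from `s+k` on; a local visit supersolution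
`ψ`: `ψ = 0` from `s+k` on, `1 + Σ_i P_q(i)·ψ(q+1+i) ≤ ψ(q)` on the window (no sign needed).  Then `S_s ≤ E·ψ(s) + S_{s+k}`. [folklore] -/
theorem window_le_of_subsolution (hP0 : ∀ q i, 0 ≤ P q i) (hPmass : ∀ q, ∑ i ∈ range Jw, P q i ≤ 1) (hE : 0 ≤ E)
    (hSsub : ∀ q, s ≤ q → q < s + k → S q ≤ E + ∑ i ∈ range Jw, P q i * S (q + 1 + i))
    (hSfar0 : ∀ q, s + k ≤ q → 0 ≤ S q) (hSfar : ∀ q, s + k ≤ q → S q ≤ S (s + k))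
    (hψoff : ∀ q, s + k ≤ q → ψ q = 0)
    (hψ : ∀ q, s ≤ q → q < s + k → 1 + ∑ i ∈ range Jw, P q i * ψ (q + 1 + i) ≤ ψ q) :
    S s ≤ E * ψ s + S (s + k) := by
  have hSk0 : 0 ≤ S (s + k) := hSfar0 _ le_rfl
  have main : ∀ d q, s + k ≤ q + d → s ≤ q → S q ≤ E * ψ q + S (s + k) := by
    intro d
    induction d with
    | zero => intro q hq _; rw [hψoff q (by omega), mul_zero, zero_add]; exact hSfar q (by omega)
    | succ d ih =>
      intro q hq hsq
      by_cases hqk : s + k ≤ q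
      · rw [hψoff q hqk, mul_zero, zero_add]; exact hSfar q hqk
      have hqk' : q < s + k := not_le.mp hqk
      have ihi : ∀ i, S (q + 1 + i) ≤ E * ψ (q + 1 + i) + S (s + k) := fun i => ih (q + 1 + i) (by omega) (by omega)
      have hb : ∑ i ∈ range Jw, P q i * S (q + 1 + i) ≤ ∑ i ∈ range Jw, P q i * (E * ψ (q + 1 + i) + S (s + k)) :=
        sum_le_sum fun i _ => mul_le_mul_of_nonneg_left (ihi i) (hP0 q i)
      have hsplit : ∑ i ∈ range Jw, P q i * (E * ψ (q + 1 + i) + S (s + k))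
          = E * ∑ i ∈ range Jw, P q i * ψ (q + 1 + i) + (∑ i ∈ range Jw, P q i) * S (s + k) := by
        rw [mul_sum, sum_mul, ← sum_add_distrib]; exact sum_congr rfl fun i _ => by ring
      have hm : (∑ i ∈ range Jw, P q i) * S (s + k) ≤ S (s + k) := by
        have := mul_le_mul_of_nonneg_right (hPmass q) hSk0; rwa [one_mul] at this
      have hx := mul_le_mul_of_nonneg_left (hψ q hsq hqk') hE
      calc S q ≤ E + ∑ i ∈ range Jw, P q i * S (q + 1 + i) := hSsub q hsq hqk'
        _ ≤ E + (E * ∑ i ∈ range Jw, P q i * ψ (q + 1 + i) + (∑ i ∈ range Jw, P q i) * S (s + k)) := by rw [← hsplit]; linarith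
        _ ≤ E * ψ q + S (s + k) := by nlinarith
  exact main k s le_rfl le_rfl

/-! ## §2 The hazard supersolution -/

/-- `(1 − c)^k ≥ 1 − k·c` for `c ≤ 1` (Bernoulli): the saturated window count `(1 − (1−c)^k)∕c` never exceeds the plain count `k`. [folklore] -/
theorem one_sub_pow_ge (hc1 : c ≤ 1) (k : ℕ) : 1 - (k : ℝ) * c ≤ (1 - c) ^ k := by
  have := one_add_mul_le_pow (show (-2 : ℝ) ≤ -c by linarith) k
  simp only [mul_neg] at this
  have e : (1 : ℝ) + -c = 1 - c := by ring
  rw [e] at this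
  linarith

/-- **THE HAZARD SUPERSOLUTION.**  Jump weights as in §1; a window `[s, s+k)`; hazards `η_q ≥ 0` with (i) `η_q ≤ Σ_{i : q+1+i ≥ s+k} P_q(i)` (a floor
for the probability of LEAVING the window from `q`) whenever `q + 2 ≤ s + k`, and (ii) `η_q·(s+k−q−1) ≤ 1` (hazard × remaining length) on the window;
`ψ` with `ψ = 0` from `s+k` on and `ψ(q) = 1 + (1 − η_q)·ψ(q+1)` on the window.  Then `0 ≤ ψ(q) ≤ s+k−q` on the window, `ψ` is non-increasing from `s` on,
and `ψ` is a local visit supersolution: `1 + Σ_i P_q(i)·ψ(q+1+i) ≤ ψ(q)` on the window.  (From `q` the chain either leaves — no further visits — or lands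
at a later position of the window, from where at most `ψ(q+1)` visits remain.) [folklore] -/
theorem hazard_supersolution (hP0 : ∀ q i, 0 ≤ P q i) (hPmass : ∀ q, ∑ i ∈ range Jw, P q i ≤ 1) (hη0 : ∀ q, 0 ≤ η q)
    (hηexit : ∀ q, s ≤ q → q + 2 ≤ s + k → η q ≤ ∑ i ∈ range Jw, if s + k ≤ q + 1 + i then P q i else 0)
    (hηR : ∀ q, s ≤ q → q < s + k → η q * (((s + k : ℕ) : ℝ) - q - 1) ≤ 1)
    (hψoff : ∀ q, s + k ≤ q → ψ q = 0) (hψrec : ∀ q, s ≤ q → q < s + k → ψ q = 1 + (1 - η q) * ψ (q + 1)) :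
    (∀ q, s ≤ q → q ≤ s + k → 0 ≤ ψ q ∧ ψ q ≤ ((s + k : ℕ) : ℝ) - q) ∧ (∀ p q, s ≤ q → q ≤ p → ψ p ≤ ψ q) ∧
      (∀ q, s ≤ q → q < s + k → 1 + ∑ i ∈ range Jw, P q i * ψ (q + 1 + i) ≤ ψ q) := by
  -- (a) bounds on the window, by the remaining length
  have hbd : ∀ d q, q + d = s + k → s ≤ q → 0 ≤ ψ q ∧ ψ q ≤ (d : ℝ) := by
    intro d
    induction d with
    | zero => intro q hq _; rw [hψoff q (by omega)]; simp
    | succ d ih =>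
      intro q hq hsq
      have h1 := ih (q + 1) (by omega) (by omega)
      rw [hψrec q hsq (by omega)]
      rcases Nat.eq_zero_or_pos d with rfl | hd
      · rw [hψoff (q + 1) (by omega), mul_zero, add_zero]; simp
      · have hR := hηR q hsq (by omega)
        have e : ((s + k : ℕ) : ℝ) - q - 1 = d := by
          have : ((q + (d + 1) : ℕ) : ℝ) = ((s + k : ℕ) : ℝ) := by rw [hq]
          push_cast at this ⊢; linarith
        rw [e] at hR
        have hd1 : (1 : ℝ) ≤ d := by exact_mod_cast hd
        have hη1 : η q ≤ 1 := by nlinarith [hη0 q]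
        have := hη0 q
        constructor
        · nlinarith [h1.1]
        · push_cast; nlinarith [h1.1, h1.2]
  have hA : ∀ q, s ≤ q → q ≤ s + k → 0 ≤ ψ q ∧ ψ q ≤ ((s + k : ℕ) : ℝ) - q := by
    intro q hsq hqk
    have h := hbd (s + k - q) q (by omega) hsq
    refine ⟨h.1, h.2.trans (le_of_eq ?_)⟩
    have : ((q + (s + k - q) : ℕ) : ℝ) = ((s + k : ℕ) : ℝ) := by rw [show q + (s + k - q) = s + k by omega]
    push_cast at this ⊢; linarith
  have hψ0 : ∀ q, s ≤ q → 0 ≤ ψ q := fun q hq => by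
    by_cases h : q ≤ s + k
    · exact (hA q hq h).1
    · rw [hψoff q (by omega)]
  -- (b) one-step monotonicity, then antitone from s on
  have hstep : ∀ q, s ≤ q → ψ (q + 1) ≤ ψ q := by
    intro q hsq
    by_cases hqk : q < s + k
    · rw [hψrec q hsq hqk]
      have h1 := hA (q + 1) (by omega) (by omega)
      have hR := hηR q hsq hqk
      have e : ((s + k : ℕ) : ℝ) - q - 1 = ((s + k : ℕ) : ℝ) - ((q + 1 : ℕ) : ℝ) := by push_cast; ring
      rw [e] at hR
      nlinarith [hη0 q, h1.1, h1.2]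
    · rw [hψoff (q + 1) (by omega), hψoff q (by omega)]
  have hB : ∀ p q, s ≤ q → q ≤ p → ψ p ≤ ψ q := by
    intro p q hsq hqp
    obtain ⟨d, rfl⟩ : ∃ d, p = q + d := ⟨p - q, by omega⟩
    clear hqp
    induction d with
    | zero => simp
    | succ d ih =>
      have h2 : ψ (q + (d + 1)) ≤ ψ (q + d) := by rw [← add_assoc]; exact hstep (q + d) (by omega)
      exact h2.trans ih
  refine ⟨hA, hB, fun q hsq hqk => ?_⟩
  -- (c) the supersolution inequality
  by_cases hlast : q + 2 ≤ s + k
  · have hex := hηexit q hsq hlast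
    have h1 : ∑ i ∈ range Jw, P q i * ψ (q + 1 + i)
        ≤ ∑ i ∈ range Jw, (P q i - (if s + k ≤ q + 1 + i then P q i else 0)) * ψ (q + 1) := by
      refine sum_le_sum fun i _ => ?_
      split_ifs with h
      · rw [hψoff _ h, sub_self]; simp
      · rw [sub_zero]; exact mul_le_mul_of_nonneg_left (hB _ _ (by omega) (by omega)) (hP0 q i)
    have h2 : ∑ i ∈ range Jw, (P q i - (if s + k ≤ q + 1 + i then P q i else 0)) * ψ (q + 1)
        = (∑ i ∈ range Jw, P q i - ∑ i ∈ range Jw, (if s + k ≤ q + 1 + i then P q i else 0)) * ψ (q + 1) := by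
      rw [← sum_sub_distrib, sum_mul]
    have h3 : (∑ i ∈ range Jw, P q i - ∑ i ∈ range Jw, (if s + k ≤ q + 1 + i then P q i else 0)) * ψ (q + 1)
        ≤ (1 - η q) * ψ (q + 1) := mul_le_mul_of_nonneg_right (by linarith [hPmass q]) (hψ0 (q + 1) (by omega))
    rw [hψrec q hsq hqk]
    linarith
  · -- the last position of the window: every jump leaves
    have hq : q + 1 = s + k := by omega
    have h0 : ∑ i ∈ range Jw, P q i * ψ (q + 1 + i) = 0 :=
      sum_eq_zero fun i _ => by rw [hψoff _ (by omega), mul_zero]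
    rw [h0, add_zero, hψrec q hsq hqk, hψoff (q + 1) (by omega), mul_zero, add_zero]

/-- **CONSTANT HAZARD.**  If `η_q = c` on the window then `c·ψ(q) = 1 − (1 − c)^{s+k−q}` for `s ≤ q ≤ s+k`; in particular the window `[s, s+k)` is
visited at most `ψ(s) = (1 − (1−c)^k)∕c` times in expectation (`c > 0`). [folklore] -/
theorem hazard_const (hψoff : ∀ q, s + k ≤ q → ψ q = 0) (hψrec : ∀ q, s ≤ q → q < s + k → ψ q = 1 + (1 - η q) * ψ (q + 1))
    (hc : ∀ q, s ≤ q → q < s + k → η q = c) : ∀ q, s ≤ q → q ≤ s + k → c * ψ q = 1 - (1 - c) ^ (s + k - q) := by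
  have main : ∀ d q, q + d = s + k → s ≤ q → c * ψ q = 1 - (1 - c) ^ d := by
    intro d
    induction d with
    | zero => intro q hq _; rw [hψoff q (by omega)]; simp
    | succ d ih =>
      intro q hq hsq
      have h1 := ih (q + 1) (by omega) (by omega)
      rw [hψrec q hsq (by omega), hc q hsq (by omega), pow_succ]
      linear_combination (1 - c) * h1
  intro q hsq hqk
  exact main (s + k - q) q (by omega) hsq

end Summit.QuantumFields.BalabanUV.Beta.EriceRemainderEnclosureHistoryAutonomyComparisonAgeCompositionUpwardChainJumps
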